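import Summits.HubbardSuperconductivity.HubbardSuperconductivity.Theses.SpinStructureRigidity
import Summits.HubbardSuperconductivity.HubbardSuperconductivity.Theorems.BalabanIRBirEveryGroundState
import HarnessLib.Audit

/-!
# Birth skeleton (BC3) — crux `SsrThermalToGround` (stmt-HubbardSuperconductivity-1490), route `SpinStructureRigidity`

`Lines/birth.lean` of `Cruxes/SsrThermalToGround/` (planner, skeleton-register one-shot, 2026-08-17).

THE CRUX (fixed; `Theses/SpinStructureRigidity.lean`, decl `SsrThermalToGround`, rank 4, DESCENT; not
restated here): for all `U > 0`, `μ`, `κ₀ > 0`, `n ∈ (3/5, 1)` — if the GRAND-CANONICAL Gibbs state of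
`hubbardTorusWith 2 L 1 U μ` at the isotropic-scaling inverse temperature `β = κL` has density `→ n`
(every `κ ≥ κ₀`) and d-wave pair order `c(κ)·L⁴ ≤ Re ω^{GC,μ}_{κL,L}(Δ_d†Δ_d)` for every `κ ≥ κ₀`
(eventually in even `L`, threshold and constant depending on `κ`), then the summit's matrix holds at
`(U, δ = 1 - n)`: EVERY normalised `(N_L, S^z = 0)`-sector ground-state sequence of the pure torus
model `hubbardTorus 2 L 1 U`, `N_L = 2⌊nL²/2⌋`, has `d_{x²-y²}` pair-field long-range order along even
sides (`Literature.Barriers.HubbardSuperconductivity.HasDWavePairFieldLROAt U (1 - n)`).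

## The cut — the route's own foreseen glued split of this node (route header, TWO-LAYER PLAN:
"SsrThermalToGround ↦ {ensemble equivalence GC(μ, κL) ↔ sector (N_L, 0), thermal-to-GS-average LRO,
GS-average-to-every-GS}"), typed over existing declarations, one registered stub per joint; the three
difficulties named in the crux's why-might-fail (phase separation at fixed `μ` · `c(κ)` without
uniformity / order of limits · degenerate sector ground spaces) are isolated ONE PER STUB.

* `stub_grandCanonicalToSector : GrandCanonicalToSector` — ENSEMBLE DESCENT AT `β = κL` (L-sized,
  open). GC density clause + GC thermal d-wave order at `β = κL` (all `κ ≥ κ₀`) ⇒ for some `κ₁ > 0`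
  and every `κ ≥ κ₁`, eventually in even `L`, the CANONICAL `(N_L = 2⌊nL²/2⌋, S^z = 0)`-sector Gibbs
  state of `hubbardTorus 2 L 1 U` at `β = κL` (`Matrix.gibbsState (κL)` of the sector-compressed
  matrices `H.toBlock p p`, exactly the objects of route LogColdTorus) has d-wave order `c'(κ)·L⁴`.
  Content: the GC state is the `e^{κLμN}Z_{N,M}`-weighted mixture of the `(N, S^z = M)`-sector Gibbs
  states and `Δ_d†Δ_d` is block-diagonal (commutes with `N̂`, `S^z`; an `SU(2)` singlet), so GC order
  is an AVERAGE of sector orders; the density clause centres the weights at `N ≈ nL²`; what is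
  claimed is equivalence of ensembles AT THE LEVEL OF THE ORDER PARAMETER in the scaling regime
  `β = κL` — concentration of `N̂` (no density jump at `μ`: the phase-separation why-might-fail lives
  here) plus insensitivity of `L⁻⁴ ω^{(N,0)}_{κL}(Δ_d†Δ_d)` to `o(L²)` changes of `N` and to the spin
  sector. Lima, CMP 24 (1971/72) (equivalence of ensembles, quantum lattice); Brandão–Cramer
  arXiv:1502.03263 (needs finite correlation length — NOT available for a gapless superconductor,
  which is why this is a stub and not a citation); Tasaki (2020) §10.1 (GC vs canonical Hubbard).
* `stub_sectorThermalToGroundAverage : SectorThermalToGroundAverage` — DESCENT IN THE SECTOR, ORDER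
  OF LIMITS (L-sized, open; the fixed-coupling `β = κL` twin of crux `LogColdToGround` of route
  LogColdTorus, with the WEAKER per-`κ` hypothesis of this crux). Sector thermal order `c(κ)·L⁴` at
  `β = κL` for every `κ ≥ κ₁` (eventually in even `L`, `c`, `L₀` depending on `κ`) ⇒ the tracial sector
  GROUND-STATE functional (`Matrix.groundStateFunctional` of `H.toBlock p p`: the uniform average over
  the sector ground space) carries order `c''·L⁴` eventually in even `L`. `L → ∞` at `β = κL` never
  reaches `β → ∞` at fixed `L` (`T = 1/(κL)` resolves no level spacing `o(1/L)`), and `c(κ) → 0` is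
  allowed by the hypothesis: the content is "no re-entrance below `T = 1/(κ₁L)`" (sufficient
  mechanisms: `d/dβ ω_β(Δ_d†Δ_d) = -Cov_β(H, Δ_d†Δ_d) ≥ 0` in budget form, cf. the registered line of
  `Cruxes/LogColdToGround/Lines/birth.lean`; or microcanonical continuity of `L⁻⁴⟨Δ_d†Δ_d⟩` at zero
  excitation-energy density, the entropy sandwich `0 ≤ ω_{κL}(H_p) - E₀ ≤ log dim/(κL) = O(L/κ)`).
  Tasaki (2020) App. A; Bratteli–Robinson II §5.3.1; re-entrance exists in frustrated Ising models
  (doi:10.1143/jpsj.55.865) — the named risk.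
* `stub_groundAverageToEveryGroundState : GroundAverageToEveryGroundState` — EVERY-GROUND-STATE
  UPGRADE AT THE CRUX'S OWN COUPLING (crux-sized residual, open). At fixed `(U, n)`: ground-state
  AVERAGE order `c·L⁴` eventually in even `L` ⇒ EVERY normalised `(N_L, S^z = 0)`-sector ground state
  `ψ` (`IsGroundStateInSector (hubbardTorus 2 L 1 U) N_L 0 ψ`, Fock form) has `c'·L⁴ ≤ Re⟨ψ, Δ_d†Δ_d ψ⟩`
  eventually in even `L`. Mechanism: irreducibility of the sector ground multiplet under the joint
  commutant `{H, N̂, S^z, Δ_d†Δ_d}'` along all large even `L` at THIS `U` + Schur ⇒ `Δ_d†Δ_d` is a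
  scalar on the ground space ⇒ every = average (landed: `Theorems.forall_unit_le_re_of_scalar`,
  `Theorems.exists_scalar_matrixElements_of_irreducible`), plus the block ↔ Fock dictionary
  (`szSector N_L 0` is the coordinate subspace of `p`; block ground energy = `minEnergyOn`). Unlike
  the window cruxes `AverageToEvery` / `BirEveryGroundState` (conclusion `∃ U ∈ (U₁,U₂)`, Kato–Rellich
  genericity available), the crux pins `U`, so accidental (symmetry-unexplained) degeneracy along
  infinitely many even `L` at this very `U` cannot be perturbed away: this stub is where
  `SsrThermalToGround`'s why-might-fail "a degenerate (N_L, S^z=0) ground space can hide an LRO-free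
  ground state from the Gibbs mixture" lives, isolated. Kato (1966) II §6.1; Tasaki (2020) §9.3;
  Lieb, PRL 62 (1989) 1201 (uniqueness proved at half filling only); Koma–Tasaki (1994) Conj. 10.
* `SsrThermalToGround_of (hA) (hB) (hC) : SsrThermalToGround` — REAL PROOF (no sorry of its own):
  thread `(U, μ, κ₀, n)` through A (get `κ₁`), B (get `c, L₁`), C (get `c', L₂`), then close with the
  landed `Theorems.hasLRO_of_forall_groundState_bound U (1 - n) c'` (every-ground-state bound at one
  coupling ⇒ the summit-format `HasLongRangeOrder` of every admissible sequence along even sides),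
  rewriting the sector size `2⌊(1 - (1 - n))L²/2⌋ = 2⌊nL²/2⌋` (`sub_sub_cancel`).

Disproof used: the crux directory has no `Disproof.lean` and no `Negative/` lemma (`ledger crux ls
stmt-HubbardSuperconductivity-1490`: no workfiles, 2026-08-17) — nothing to honour yet; when a
disprover lands `SsrThermalToGround_false_without_<H>`, the `H` it names must be consumed by the stub
that sees it (density clause / `μ`: stub A; `κ`-uniformity: stub B; ground-space structure: stub C).
Sibling negative knowledge checked: `Cruxes/BirEveryGroundState/Disproof.lean`
(`not_abstractDarkPartnerExclusion`: the MODEL-FREE average → every transfer is false, 5×5 pencil;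
`not_pointwiseTransfer_L4`: the side `L = 4` is anomalous) — stub C is typed on the Hubbard torus
and eventually in `L`, not an instance of either; `ledger negatives --problem HubbardSuperconductivity`
(2 entries: CooperPairDMottWalk breathing self-duality, AposterioriCapRg KLS openness) — unrelated
shapes. No definition is introduced for the tree; the read-back vocabulary below is local
abbreviation of verbatim sub-terms of the crux and of route LogColdTorus's sector objects.
-/

noncomputable section

-- `dupNamespace`: the summit and the problem are both named `HubbardSuperconductivity` (layout D-0022)
set_option linter.dupNamespace false
set_option linter.unusedVariables false

namespace Summit.HubbardSuperconductivity.HubbardSuperconductivity.Cruxes.SsrThermalToGround.Birth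

open scoped BigOperators Topology Classical Matrix ComplexConjugate ComplexOrder
open Filter Set Function
open Literature.Hubbard
open Literature.Probability.LatticeModels Literature.MathematicalPhysics.QuantumLattice
open Summit.HubbardSuperconductivity.HubbardSuperconductivity.Theses.SpinStructureRigidity

/-! ## Read-back vocabulary (verbatim sub-terms of the crux; sector objects as in route LogColdTorus) -/

/-- The GC DENSITY CLAUSE of the crux with data `(U, μ, κ₀, n)` — verbatim its first hypothesis: for
every `κ ≥ κ₀` the grand-canonical Gibbs density of `hubbardTorusWith 2 L 1 U μ` at `β = κL` tends to
`n` (indexed by `L + 1` to avoid the empty torus). -/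
def GcDensityClause (U μ κ₀ n : ℝ) : Prop :=
  ∀ κ : ℝ, κ₀ ≤ κ → Filter.Tendsto (fun L : ℕ => ((Literature.MathematicalPhysics.QuantumLattice.hubbardTorusWith 2 (L + 1) 1 U μ).gibbsState (κ * ((L + 1 : ℕ) : ℝ)) Literature.MathematicalPhysics.QuantumLattice.totalNumber).re / ((L + 1 : ℕ) : ℝ) ^ 2) Filter.atTop (nhds n)

/-- The GC THERMAL d-WAVE ORDER clause of the crux with data `(U, μ, κ₀)` — verbatim its second
hypothesis: for every `κ ≥ κ₀` there are `c > 0`, `L₀` with `c·L⁴ ≤ Re ω^{GC,μ}_{κL,L}(Δ_d†Δ_d)` for all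
even `L ≥ L₀` (`Δ_d = pairField dWaveFormFactor L = √2·Δ_d` of the summit). -/
def GcThermalDWaveOrder (U μ κ₀ : ℝ) : Prop :=
  ∀ κ : ℝ, κ₀ ≤ κ → ∃ c : ℝ, 0 < c ∧ ∃ L₀ : ℕ, ∀ (L : ℕ) [NeZero L], Even L → L₀ ≤ L → c * (L : ℝ) ^ 4 ≤ ((Literature.MathematicalPhysics.QuantumLattice.hubbardTorusWith 2 L 1 U μ).gibbsState (κ * L) ((Literature.MathematicalPhysics.QuantumLattice.pairField Literature.MathematicalPhysics.QuantumLattice.dWaveFormFactor L)ᴴ * Literature.MathematicalPhysics.QuantumLattice.pairField Literature.MathematicalPhysics.QuantumLattice.dWaveFormFactor L)).re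

/-- SECTOR THERMAL d-WAVE ORDER at `β = κL` with data `(U, n, κ₁)`: for every `κ ≥ κ₁` there are
`c > 0`, `L₀` such that for all even `L ≥ L₀` the canonical `(N_L, S^z = 0)`-sector Gibbs state of the
pure model `hubbardTorus 2 L 1 U` at `β = κL` — `Matrix.gibbsState (κL)` of the compression
`H.toBlock p p` to the occupation sets `s` with `#s = N_L = 2⌊nL²/2⌋` and `2·#{↑ ∈ s} = N_L` (the
sector objects of route LogColdTorus; `μ` drops out at fixed `N`) — has `c·L⁴ ≤ Re ω^{sec}_{κL,L}(Δ_d†Δ_d)`. -/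
def SectorThermalDWaveOrder (U n κ₁ : ℝ) : Prop :=
  ∀ κ : ℝ, κ₁ ≤ κ → ∃ c : ℝ, 0 < c ∧ ∃ L₀ : ℕ, ∀ (L : ℕ) [NeZero L], Even L → L₀ ≤ L →
    let p : Finset (Orb (FermionTorus 2 L)) → Prop := fun s =>
      s.card = 2 * ⌊n * (L : ℝ) ^ 2 / 2⌋₊ ∧ 2 * (s.filter fun i => (ofLex i).2 = 0).card = 2 * ⌊n * (L : ℝ) ^ 2 / 2⌋₊
    c * (L : ℝ) ^ 4 ≤ (Matrix.gibbsState (κ * L) ((hubbardTorus 2 L 1 U).toBlock p p)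
      (((pairField dWaveFormFactor L)ᴴ * pairField dWaveFormFactor L).toBlock p p)).re

/-- SECTOR GROUND-STATE-AVERAGE d-WAVE ORDER with data `(U, n, c, L₁)`: for all even `L ≥ L₁` the
tracial ground-state functional (`Matrix.groundStateFunctional`, the uniform mixture of the sector
ground states) of the `(N_L = 2⌊nL²/2⌋, S^z = 0)`-compressed `hubbardTorus 2 L 1 U` gives the compressed
`Δ_d†Δ_d` real part `≥ c·L⁴` (the hub object of cruxes `LogColdToGround` / `AverageToEvery`, at density `n`). -/
def SectorGroundAverageDWaveOrder (U n c : ℝ) (L₁ : ℕ) : Prop :=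
  ∀ (L : ℕ) [NeZero L], Even L → L₁ ≤ L →
    let p : Finset (Orb (FermionTorus 2 L)) → Prop := fun s =>
      s.card = 2 * ⌊n * (L : ℝ) ^ 2 / 2⌋₊ ∧ 2 * (s.filter fun i => (ofLex i).2 = 0).card = 2 * ⌊n * (L : ℝ) ^ 2 / 2⌋₊
    c * (L : ℝ) ^ 4 ≤ (((hubbardTorus 2 L 1 U).toBlock p p).groundStateFunctional
      (((pairField dWaveFormFactor L)ᴴ * pairField dWaveFormFactor L).toBlock p p)).re

/-- EVERY-GROUND-STATE d-WAVE BOUND with data `(U, n, c, L₂)`: for all even `L ≥ L₂`, EVERY normalised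
Fock-space ground state `ψ` of `hubbardTorus 2 L 1 U` in the sector `(N_L = 2⌊nL²/2⌋, S^z = 0)`
(`IsGroundStateInSector`) has `c·L⁴ ≤ Re⟨ψ, Δ_d†Δ_d ψ⟩` — exactly the hypothesis shape of the landed
`Theorems.hasLRO_of_forall_groundState_bound` at `δ = 1 - n`. -/
def EverySectorGroundStateDWaveBound (U n c : ℝ) (L₂ : ℕ) : Prop :=
  ∀ (L : ℕ) [NeZero L], L₂ ≤ L → Even L → ∀ ψ : Fock (Orb (FermionTorus 2 L)),
    IsGroundStateInSector (hubbardTorus 2 L 1 U) (2 * ⌊n * (L : ℝ) ^ 2 / 2⌋₊) 0 ψ →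
    star ψ ⬝ᵥ ψ = 1 →
    c * (L : ℝ) ^ 4 ≤ (star ψ ⬝ᵥ ((pairField dWaveFormFactor L)ᴴ * pairField dWaveFormFactor L) *ᵥ ψ).re

/-! ## The three stub statements -/

/-- **Stub statement A — `GrandCanonicalToSector`** (ENSEMBLE DESCENT at `β = κL`; L-sized, open).
For all `U > 0`, `μ`, `κ₀ > 0`, `n ∈ (3/5, 1)`: the GC density clause and the GC thermal d-wave order
of the crux imply, for some `κ₁ > 0`, SECTOR thermal d-wave order at `β = κL` for every `κ ≥ κ₁` in the
canonical `(2⌊nL²/2⌋, S^z = 0)` sector of the pure torus model (constants and thresholds may change).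
Equivalence of ensembles at the level of the pair order parameter in the scaling regime `β = κL`.
Lima, CMP 24 (1971/72); Brandão–Cramer arXiv:1502.03263; Tasaki (2020) §10.1. -/
def GrandCanonicalToSector : Prop :=
  ∀ (U μ κ₀ n : ℝ), 0 < U → 0 < κ₀ → n ∈ Set.Ioo (3 / 5 : ℝ) 1 →
    GcDensityClause U μ κ₀ n → GcThermalDWaveOrder U μ κ₀ →
    ∃ κ₁ : ℝ, 0 < κ₁ ∧ SectorThermalDWaveOrder U n κ₁

/-- **Stub statement B — `SectorThermalToGroundAverage`** (DESCENT IN THE SECTOR / ORDER OF LIMITS;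
L-sized, open). For all `U > 0`, `n ∈ (3/5, 1)`, `κ₁ > 0`: sector thermal d-wave order at `β = κL` for
every `κ ≥ κ₁` (per-`κ` constants) implies ground-state-AVERAGE d-wave order `c·L⁴` of the sector,
eventually in even `L`. No re-entrance below `T = 1/(κ₁L)`. Tasaki (2020) App. A; Bratteli–Robinson
II §5.3.1; doi:10.1143/jpsj.55.865 (re-entrance, the named risk). -/
def SectorThermalToGroundAverage : Prop :=
  ∀ (U n κ₁ : ℝ), 0 < U → n ∈ Set.Ioo (3 / 5 : ℝ) 1 → 0 < κ₁ →
    SectorThermalDWaveOrder U n κ₁ →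
    ∃ c : ℝ, 0 < c ∧ ∃ L₁ : ℕ, SectorGroundAverageDWaveOrder U n c L₁

/-- **Stub statement C — `GroundAverageToEveryGroundState`** (EVERY-GROUND-STATE UPGRADE AT THE
CRUX'S OWN COUPLING; crux-sized residual, open). For all `U > 0`, `n ∈ (3/5, 1)`, `c > 0`, `L₁`:
ground-state-average d-wave order `c·L⁴` in the `(2⌊nL²/2⌋, S^z = 0)` sector for all even `L ≥ L₁`
implies, for some `c' > 0` and `L₂`, that EVERY normalised sector ground state has `c'·L⁴ ≤
Re⟨ψ, Δ_d†Δ_d ψ⟩` for all even `L ≥ L₂`. Irreducibility of the ground multiplet under the joint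
commutant along all large even `L` at this `U` + Schur (landed `Theorems.forall_unit_le_re_of_scalar`);
the fixed-`U` form of the window cruxes `AverageToEvery` / `BirEveryGroundState`. Kato (1966) II §6.1;
Tasaki (2020) §9.3; Lieb, PRL 62 (1989) 1201; Koma–Tasaki (1994) Conj. 10. -/
def GroundAverageToEveryGroundState : Prop :=
  ∀ (U n c : ℝ) (L₁ : ℕ), 0 < U → n ∈ Set.Ioo (3 / 5 : ℝ) 1 → 0 < c →
    SectorGroundAverageDWaveOrder U n c L₁ →
    ∃ c' : ℝ, 0 < c' ∧ ∃ L₂ : ℕ, EverySectorGroundStateDWaveBound U n c' L₂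

/-! ## Registered stubs -/

/-- **Registered stub A (ensemble descent at `β = κL`, L, open): GC thermal order + density ⇒
canonical-sector thermal order.** See `GrandCanonicalToSector`. -/
theorem stub_grandCanonicalToSector : GrandCanonicalToSector := by
  sorry

/-- **Registered stub B (descent in the sector, order of limits, L, open): sector thermal order for
all `κ ≥ κ₁` ⇒ ground-state-average order.** See `SectorThermalToGroundAverage`. -/
theorem stub_sectorThermalToGroundAverage : SectorThermalToGroundAverage := by
  sorry

/-- **Registered stub C (every-ground-state upgrade at fixed coupling, crux-sized residual, hardest):
ground-state-average order ⇒ every normalised sector ground state carries order.**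
See `GroundAverageToEveryGroundState`. -/
theorem stub_groundAverageToEveryGroundState : GroundAverageToEveryGroundState := by
  sorry

/-! ## Registered texts of the stubs (the audit admits exactly these names as hypotheses) -/

namespace Registered

/-- Registered text of `stub_grandCanonicalToSector`. -/
abbrev stub_grandCanonicalToSector : Prop := GrandCanonicalToSector

/-- Registered text of `stub_sectorThermalToGroundAverage`. -/
abbrev stub_sectorThermalToGroundAverage : Prop := SectorThermalToGroundAverage

/-- Registered text of `stub_groundAverageToEveryGroundState`. -/
abbrev stub_groundAverageToEveryGroundState : Prop := GroundAverageToEveryGroundState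

end Registered

/-! ## The composition (kernel-checked, no sorry of its own) -/

/-- **Skeleton theorem.** The three stubs imply the crux `Theses.SpinStructureRigidity.SsrThermalToGround`
BY NAME: from the crux's data `(U, μ, κ₀, n)` and its two hypotheses (GC density clause, GC thermal
d-wave order at `β = κL`), stub A gives sector thermal order for `κ ≥ κ₁`, stub B the sector
ground-state-average order `c·L⁴` (even `L ≥ L₁`), stub C the every-ground-state bound `c'·L⁴` (even
`L ≥ L₂`) at the SAME coupling `U`; the landed `Theorems.hasLRO_of_forall_groundState_bound U (1 - n) c'`
(Scalapino's pair-field LRO of every admissible sequence from an eventual every-ground-state bound)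
closes `HasDWavePairFieldLROAt U (1 - n)` after rewriting the sector size
`2⌊(1 - (1 - n))L²/2⌋ = 2⌊nL²/2⌋`. -/
theorem SsrThermalToGround_of (hA : Registered.stub_grandCanonicalToSector)
    (hB : Registered.stub_sectorThermalToGroundAverage)
    (hC : Registered.stub_groundAverageToEveryGroundState) : SsrThermalToGround := by
  intro U μ κ₀ n hU hκ₀ hn hdens hlro
  -- A: grand-canonical (μ, β = κL) ⇒ canonical (N_L, S^z = 0) sector, β = κL, κ ≥ κ₁
  obtain ⟨κ₁, hκ₁, hsec⟩ := hA U μ κ₀ n hU hκ₀ hn hdens hlro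
  -- B: sector thermal order for all κ ≥ κ₁ ⇒ sector ground-state-average order
  obtain ⟨c, hc, L₁, havg⟩ := hB U n κ₁ hU hn hκ₁ hsec
  -- C: ground-state average ⇒ every normalised sector ground state, at this very U
  obtain ⟨c', hc', L₂, hevery⟩ := hC U n c L₁ hU hn hc havg
  -- the summit's matrix at (U, δ = 1 - n) from the every-ground-state bound (landed theorem)
  unfold Literature.Barriers.HubbardSuperconductivity.HasDWavePairFieldLROAt
  intro N ψ hadm
  refine Summit.HubbardSuperconductivity.HubbardSuperconductivity.Theorems.hasLRO_of_forall_groundState_bound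
    U (1 - n) c' hc' L₂ ?_ N ψ hadm
  intro L _ hL hev φ hgs hunit
  rw [sub_sub_cancel] at hgs
  exact hevery L hL hev φ hgs hunit

end Summit.HubbardSuperconductivity.HubbardSuperconductivity.Cruxes.SsrThermalToGround.Birth

end
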